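import Literature.AnabelianGeometry.EtaleTheta.Discharge.Sec1Thm16iiiOfInversionClauses
import Literature.AnabelianGeometry.EtaleTheta.Discharge.Sec2ThetaOrbitClasses
import Literature.AnabelianGeometry.EtaleTheta.Discharge.Sec2GeometricConjClasses
import Literature.AnabelianGeometry.EtaleTheta.Discharge.Sec1InvNegatesFdd1Quot
import Literature.AnabelianGeometry.EtaleTheta.ThetaKummerDeck
import HarnessLib

/-!
# [EtTh] Prop. 1.5 (iii) / Thm. 1.6 (iii) at `γ = ι`: the `O^×_K̈`-ambiguity of `η̈^Θ` under an inversion is a SIGN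
# (the «H14ORBIT root question» of the L2 census — POSITIVE modulo two print-level clauses; proof-only)

Mochizuki, *The étale theta function and its Frobenioid-theoretic manifestations*, Publ. RIMS **45** (2009) [EtTh],
Prop. 1.5 (iii) p. 23 («any inversion automorphism ι … fixes η̈^Θ + log(O^×_K̈)»), Prop. 1.4 (ii) p. 22
(«Θ̈(−Ü) = −Θ̈(Ü)»), Thm. 1.6 (iii) p. 25 [cite: MochizukiEtTh2009, Prop 1.5 (iii) p.23].

abc-iut cell, layer L2, seat abc-iut-L2-t1 (§1 ROOT owner, gen 7; abc-iut-L2-lead R584/R632 census question «O^×_K̈-ambiguity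
of η̈^Θ at the root — derivable from the root predicates, or NEGATIVE?»). PROOF-ONLY (no definition, no `Prop`-valued
definition, no new named fact).

THE QUESTION. At the root, the inversion clause `ThetaSetting.InvClauses E hι cι` (⟸ `Prop15iiiInvAnchored E` + one
anchored label-`0` cusp fixed by `ι`) says `transport_ι '' (O^×·η̈^Θ) = O^×·η̈^Θ`, i.e. `transport_ι(η̈^Θ) = κ(w)·η̈^Θ` for
SOME unit `w ∈ O^×_K̈` (`InvClauses.transport_mem`); the consumers' binder h14orbit ([IUTchII] Prop. 2.2 (ii) at the
model, abc-iut-w4-d010 / L2-t12) wants `transport_ι(η̈^Θ)` inside the `Π^tp_Y`-ORBIT `{η̈^Θ, κ(−1)·η̈^Θ}` — i.e.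
`w ∈ {±1}`. THE ANSWER typed here: `w` is intrinsic to `ι` and **`w² = 1`, hence `w = ±1`**, GRANTED two clauses of
print that the root predicates `IsInversionAut` / `InvClauses` do not carry —
(h_kum) «`ι` fixes the (inflated) Kummer classes of constants» (`ι` lies over `K` and acts by `+1` on `Δ_Θ`; at the
root `KummerData.kumYdd` is abstract DATA, so this is a clause — Thm. 1.6 (ii) clause (a) with `δ := id`), and
(h_sq) «`ι²` is inner by an element of `Π^tp_Ÿ`» (the POINTED inversion: `ι² = id` on the curve, so on `Π^tp_X` up to
the chosen base point; [IUTchII] Rmk. 2.1.1 (i), the L6 binder `hιι`):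
then `transport_ι ∘ transport_ι = conj_δ = id` on `H¹(Π^tp_Ÿ, Δ_Θ)` (inner automorphisms act trivially,
`ContH1.conj_eq_self_of_mem`), so `κ(w)² = 1`, so `w² = 1` (injectivity of `κ`), so `w = ±1` (`K̈` is a field).
* `ThetaSetting.transport_transport_eq_conj_of_sq_inner` — for ANY automorphism `ι` with `ι(Π^tp_Ÿ) = Π^tp_Ÿ`, a theta
  companion and `ι² = conj_δ`: `transport ∘ transport = ContH1.conj δ` (cocycle-level; the companion of `ι²` is
  `conj_{δ^Θ}` by surjectivity of `(·)^Θ`);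
* **`ThetaSetting.InvClauses.exists_sign_transport_etaDd`** — `∃ w ∈ O^×_K̈, (w = 1 ∨ w = −1) ∧
  transport_ι(η̈^Θ) = κ(w)·η̈^Θ`; `…_of_prop15iiiInvAnchored` (the same from `Prop15iiiInvAnchored` + an anchored label-`0`
  cusp fixed by `ι`);
* `ThetaSetting.InvClauses.toKddHat_sq_eq_of_sq_inner` — the general square relation `w² = s` when `ι² = conj_δ` and
  `conj_δ(η̈^Θ) = κ(s)·η̈^Θ` (so: `δ` acting trivially ⇒ sign; `δ` a deck element ⇒ `w` a primitive 4th root of unity and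
  the orbit form fails — the precise dividing line of the census question);
* `ThetaSetting.InvClauses.exists_mem_GtpY_transport_etaDd_eq_conj` — the ORBIT form (h14orbit at the root):
  `∃ τ₀ ∈ Π^tp_Y, transport_ι(η̈^Θ) = conj_{τ₀}(η̈^Θ)`, given in addition the CLASS-LEVEL deck-sign clause
  «`conj_ε(η̈^Θ) = κ(−1)·η̈^Θ` for a deck element `ε ∈ Π^tp_Y`» (Prop. 1.4 (ii) `Θ̈(−Ü) = −Θ̈(Ü)` at class level; the
  `κ₁ := κ(−1)` instance of w4-d010's h14sign).
APPENDED v2 (same seat): (h_kum) is DISCHARGED from Prop. 1.5 (ii) — `IsInversionAut.transport_inflTheta_eq_self_of_mem_Fdd2`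
(an inversion fixes every inflated `F̈²`-class: a representative cocycle kills `(Δ^tp_Ÿ)^Θ`, `ι^Θ = id` on `Δ_Θ`, `ι` lies
over `K`), `IsInversionAut.transport_infl_kumYdd_eq_self` (`F̈² = κ((K̈^×)^∧)`), hence
`InvClauses.exists_sign_transport_etaDd_of_prop15ii` / `exists_sign_transport_etaDd_of_prop15`: **the sign needs (h_sq) ONLY**
beyond the K3 knits' standing binders (`Compat`, `Prop15ii`, `Prop15iiiInvAnchored` + an anchored label-`0` cusp).
APPENDED v3: (h_sq) LOCATED — `IsInversionAut.sqInner_mem_GtpY` (`ι² = conj_δ` with `Π^tp_X` centre-free ⇒ `ι δ = δ` ⇒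
`δ ∈ Π^tp_Y`: the clause is the `ℤ/2`-valued DECK CLASS of `δ`), `InvClauses.transport_etaDd_not_mem_orbit_of_sq_deck` (deck
class non-trivial + deck-sign clause ⇒ `w² = −1`, orbit form FAILS) and **`InvClauses.transport_etaDd_mem_orbit_iff_sq_mem_GtpYdd`**
(given Prop. 1.5 (ii), `InvClauses`, the deck-sign clause for all deck elements: the h14orbit sign form ⟺ `δ ∈ Π^tp_Ÿ`).
Also: the class-level deck-sign clause itself from the FUNCTION level (`EtaleThetaData.conj_etaDd_eq_of_deck_of_thetaKummer`:
`η̈^Θ = κ(Θ̈)`, `ConstCompat`, «`Θ̈ ↦ −Θ̈`» via abc-iut-w5-d125's `conj_kummerTheta_of_deck`) and the all-print-inputs orbit form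
`InvClauses.exists_mem_GtpY_transport_etaDd_eq_conj_of_thetaKummer`.
WHAT IS NOT CLAIMED: which deck class a given inversion datum has (for the POINTED inversion of print, `δ = 1`).
HONEST FRAMING: [EtTh] is refereed; nothing asserted; typed ≠ proved; nothing here bears on [IUTchIII] Cor. 3.12.
-/

noncomputable section

namespace Literature.AnabelianGeometry.EtaleTheta

open Literature.AnabelianGeometry.SemiGraphs

namespace ThetaSetting

variable {p : ℕ} [Fact p.Prime] {D : ThetaSetting p}

/-! ### Transport along `ι` twice = conjugation by `δ` when `ι² = conj_δ` -/

/-- **`transport_ι ∘ transport_ι = conj_δ` on `H¹(Π^tp_Ÿ, Δ_Θ)` when `ι² = conj_δ`** (`ι(Π^tp_Ÿ) = Π^tp_Ÿ`, theta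
companion `c`): both classes are represented by `y ↦ δ^Θ · f(δ⁻¹ y δ) · (δ^Θ)⁻¹`, because the companion satisfies
`c.thetaIso (c.thetaIso t) = δ^Θ t (δ^Θ)⁻¹` (surjectivity of `(·)^Θ` and `(·)^Θ ∘ ι = ι^Θ ∘ (·)^Θ`).
[cite: MochizukiEtTh2009, Thm 1.6 (iii) p.24] -/
theorem transport_transport_eq_conj_of_sq_inner [D.GtpYdd.Normal] {ι : D.PiTemp ≃ₜ* D.PiTemp}
    (c : ThetaCompanion ι) (h : Thm16i ι) {δ : D.PiTemp} (hδ : ∀ x, ι (ι x) = δ * x * δ⁻¹)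
    (x : D.H1 D.GtpYdd) :
    transport c h (transport c h x) = ContH1.conj D.toTheta D.DeltaTheta δ x := by
  obtain ⟨f, rfl⟩ := QuotientGroup.mk_surjective x
  change (QuotientGroup.mk (transportCocycle c h (transportCocycle c h f)) : D.H1 D.GtpYdd) =
    QuotientGroup.mk (ContH1.conjCocycle D.toTheta D.DeltaTheta δ f)
  congr 1
  apply Subtype.ext
  funext y
  apply Subtype.ext
  -- the two points of `Π^tp_Ÿ` at which `f` is evaluated coincide: `ι⁻¹(ι⁻¹ y) = δ⁻¹ y δ`
  have hpt : (⟨ι.toMulEquiv.symm (ι.toMulEquiv.symm y.1),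
        symm_mem_GtpYdd h ⟨ι.toMulEquiv.symm y.1, symm_mem_GtpYdd h y⟩⟩ : D.GtpYdd) =
      MulAut.conjNormal δ⁻¹ y := by
    apply Subtype.ext
    change ι.toMulEquiv.symm (ι.toMulEquiv.symm y.1) = δ⁻¹ * y.1 * δ⁻¹⁻¹
    apply ι.injective
    apply ι.injective
    change ι.toMulEquiv (ι.toMulEquiv (ι.toMulEquiv.symm (ι.toMulEquiv.symm y.1))) = ι (ι (δ⁻¹ * y.1 * δ⁻¹⁻¹))
    rw [MulEquiv.apply_symm_apply, MulEquiv.apply_symm_apply, hδ]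
    group
  -- the companion applied twice is conjugation by `δ^Θ`
  have hθθ : ∀ t : D.GtpTheta,
      c.thetaIso.toMulEquiv (c.thetaIso.toMulEquiv t) = D.toTheta δ * t * (D.toTheta δ)⁻¹ := by
    intro t
    obtain ⟨z, rfl⟩ := D.toTheta_surjective t
    rw [← c.comm, ← c.comm]
    change D.toTheta (ι (ι z)) = _
    rw [hδ, map_mul, map_mul, map_inv]
  have L : ((((transportCocycle c h (transportCocycle c h f)).1 y) : D.DeltaTheta) : D.GtpTheta) =
      c.thetaIso.toMulEquiv (c.thetaIso.toMulEquiv (f.1 ⟨ι.toMulEquiv.symm (ι.toMulEquiv.symm y.1),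
        symm_mem_GtpYdd h ⟨ι.toMulEquiv.symm y.1, symm_mem_GtpYdd h y⟩⟩).1) := rfl
  have R : ((((ContH1.conjCocycle D.toTheta D.DeltaTheta δ f).1 y) : D.DeltaTheta) : D.GtpTheta) =
      D.toTheta δ * (f.1 (MulAut.conjNormal δ⁻¹ y)).1 * (D.toTheta δ)⁻¹ := by
    rw [ContH1.conjCocycle_apply]
    exact MulAut.conjNormal_apply _ _
  rw [L, R, hθθ, hpt]

/-! ### The sign of an inversion on `η̈^Θ` -/

namespace InvClauses

variable {E : D.EtaleThetaData} {ι : D.PiTemp ≃ₜ* D.PiTemp} {hι : D.IsInversionAut ι} {cι : ThetaCompanion ι}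

/-- Clause (1) of Prop. 1.5 (iii) for `η̈^Θ` itself: `transport_ι(η̈^Θ) = κ(w)·η̈^Θ` for some unit `w ∈ O^×_K̈`.
[cite: MochizukiEtTh2009, Prop 1.5 (iii) p.23] -/
theorem exists_unit_transport_etaDd (h : InvClauses E hι cι) :
    ∃ w ∈ D.unitsOKdd,
      transport cι hι.thm16i E.etaDd = D.inflTheta D.GtpYdd (E.kumYdd (E.toKddHat w)) * E.etaDd := by
  obtain ⟨k, hk, hT⟩ := h.transport_mem (E := E) ⟨1, one_mem _, (one_mul _).symm⟩
  obtain ⟨cw, ⟨w, hw, rfl⟩, rfl⟩ := hk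
  exact ⟨w, hw, hT⟩

/-- **The `O^×_K̈`-ambiguity of `η̈^Θ` under an inversion is a SIGN.** For an inversion automorphism `ι` with
theta companion `cι` satisfying the inversion clause of Prop. 1.5 (iii) (`InvClauses`), GRANTED (h_kum) «`ι` fixes the
inflated Kummer classes of constants» and (h_sq) «`ι² = conj_δ` with `δ ∈ Π^tp_Ÿ`»: the unit `w` with
`transport_ι(η̈^Θ) = κ(w)·η̈^Θ` satisfies `w = ±1`. PROOF: transporting twice gives `κ(w)²·η̈^Θ` by (h_kum) and `η̈^Θ` by
(h_sq) (`transport_transport_eq_conj_of_sq_inner`, inner automorphisms act trivially on `H¹`); cancel `η̈^Θ`, then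
`κ` and `O^×_K̈ ↪ (K̈^×)^∧` are injective and `K̈` is a field. [cite: MochizukiEtTh2009, Prop 1.5 (iii) p.23] -/
theorem exists_sign_transport_etaDd [D.GtpYdd.Normal] (h : InvClauses E hι cι)
    (hkum : ∀ a : E.KddHat, transport cι hι.thm16i (D.inflTheta D.GtpYdd (E.kumYdd a)) =
      D.inflTheta D.GtpYdd (E.kumYdd a))
    {δ : D.PiTemp} (hδYdd : δ ∈ D.GtpYdd) (hδ : ∀ x, ι (ι x) = δ * x * δ⁻¹) :
    ∃ w ∈ D.unitsOKdd, (w = 1 ∨ w = -1) ∧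
      transport cι hι.thm16i E.etaDd = D.inflTheta D.GtpYdd (E.kumYdd (E.toKddHat w)) * E.etaDd := by
  obtain ⟨w, hw, hT⟩ := h.exists_unit_transport_etaDd
  refine ⟨w, hw, ?_, hT⟩
  set κw := D.inflTheta D.GtpYdd (E.kumYdd (E.toKddHat w)) with hκw
  -- transporting twice: `κw² · η̈` on the one hand, `η̈` on the other
  have h2 : transport cι hι.thm16i (transport cι hι.thm16i E.etaDd) = κw * (κw * E.etaDd) := by
    rw [hT, map_mul, hkum, hT]
  have h1 : transport cι hι.thm16i (transport cι hι.thm16i E.etaDd) = E.etaDd := by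
    rw [transport_transport_eq_conj_of_sq_inner cι hι.thm16i hδ,
      ContH1.conj_eq_self_of_mem δ hδYdd]
  have hsq : κw * κw = 1 := by
    have h3 : κw * κw * E.etaDd = 1 * E.etaDd := by rw [mul_assoc, ← h2, h1, one_mul]
    exact mul_right_cancel h3
  -- injectivity of `κ` and of `O^×_K̈ ↪ (K̈^×)^∧`
  have hww : E.toKddHat (w * w) = E.toKddHat 1 := by
    apply Thm16Sub.inflKum_injective E.toKummerData
    change D.inflTheta D.GtpYdd (E.kumYdd (E.toKddHat (w * w))) = D.inflTheta D.GtpYdd (E.kumYdd (E.toKddHat 1))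
    rw [map_mul, map_mul, map_mul, map_one, map_one, map_one]
    exact hsq
  have hw2 : w * w = 1 := E.toKddHat_injective hww
  -- `K̈` is a field: `w·w = 1 ⇒ w = ±1`
  have hval : ((w : D.Kdd) : D.Kdd) * (w : D.Kdd) = 1 := by
    rw [← Units.val_mul, hw2, Units.val_one]
  rcases mul_self_eq_one_iff.mp hval with h1' | h1'
  · left
    exact Units.ext h1'
  · right
    exact Units.ext (by rw [h1', Units.val_neg, Units.val_one])

/-- **The general square relation** (both directions of the census question in one line): if `ι² = conj_δ` for
ANY `δ ∈ Π^tp_X` and `conj_δ(η̈^Θ) = κ(s)·η̈^Θ` (e.g. `s = 1` for `δ ∈ Π^tp_Ÿ`, `s = −1` for a deck element `δ ∈ Π^tp_Y ∖ Π^tp_Ÿ`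
by Prop. 1.4 (ii)), then the unit `w` of `transport_ι(η̈^Θ) = κ(w)·η̈^Θ` satisfies **`w² = s`** in `(K̈^×)^∧` — so `w = ±1`
exactly when `ι²` is inner by an element acting TRIVIALLY on `η̈^Θ`; were `ι²` inner by a deck element, `w` would be a
primitive fourth root of unity and the orbit form would FAIL. [cite: MochizukiEtTh2009, Prop 1.5 (iii) p.23] -/
theorem toKddHat_sq_eq_of_sq_inner [D.GtpYdd.Normal] (h : InvClauses E hι cι)
    (hkum : ∀ a : E.KddHat, transport cι hι.thm16i (D.inflTheta D.GtpYdd (E.kumYdd a)) =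
      D.inflTheta D.GtpYdd (E.kumYdd a))
    {δ : D.PiTemp} (hδ : ∀ x, ι (ι x) = δ * x * δ⁻¹) {s : E.KddHat}
    (hs : ContH1.conj D.toTheta D.DeltaTheta δ E.etaDd = D.inflTheta D.GtpYdd (E.kumYdd s) * E.etaDd) :
    ∃ w ∈ D.unitsOKdd, E.toKddHat (w * w) = s ∧
      transport cι hι.thm16i E.etaDd = D.inflTheta D.GtpYdd (E.kumYdd (E.toKddHat w)) * E.etaDd := by
  obtain ⟨w, hw, hT⟩ := h.exists_unit_transport_etaDd
  refine ⟨w, hw, ?_, hT⟩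
  set κw := D.inflTheta D.GtpYdd (E.kumYdd (E.toKddHat w)) with hκw
  have h2 : transport cι hι.thm16i (transport cι hι.thm16i E.etaDd) = κw * (κw * E.etaDd) := by
    rw [hT, map_mul, hkum, hT]
  have h1 : transport cι hι.thm16i (transport cι hι.thm16i E.etaDd) = D.inflTheta D.GtpYdd (E.kumYdd s) * E.etaDd := by
    rw [transport_transport_eq_conj_of_sq_inner cι hι.thm16i hδ, hs]
  have hsq : κw * κw = D.inflTheta D.GtpYdd (E.kumYdd s) := by
    have h3 : κw * κw * E.etaDd = D.inflTheta D.GtpYdd (E.kumYdd s) * E.etaDd := by rw [mul_assoc, ← h2, h1]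
    exact mul_right_cancel h3
  apply Thm16Sub.inflKum_injective E.toKummerData
  change D.inflTheta D.GtpYdd (E.kumYdd (E.toKddHat (w * w))) = D.inflTheta D.GtpYdd (E.kumYdd s)
  rw [map_mul, map_mul, map_mul]
  exact hsq

/-- The same in disjunctive form: `transport_ι(η̈^Θ) = η̈^Θ` or `= κ(−1)·η̈^Θ`. [cite: MochizukiEtTh2009, Prop 1.5 (iii) p.23] -/
theorem transport_etaDd_eq_or [D.GtpYdd.Normal] (h : InvClauses E hι cι)
    (hkum : ∀ a : E.KddHat, transport cι hι.thm16i (D.inflTheta D.GtpYdd (E.kumYdd a)) =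
      D.inflTheta D.GtpYdd (E.kumYdd a))
    {δ : D.PiTemp} (hδYdd : δ ∈ D.GtpYdd) (hδ : ∀ x, ι (ι x) = δ * x * δ⁻¹) :
    transport cι hι.thm16i E.etaDd = E.etaDd ∨
      transport cι hι.thm16i E.etaDd = D.inflTheta D.GtpYdd (E.kumYdd (E.toKddHat (-1))) * E.etaDd := by
  obtain ⟨w, -, hw | hw, hT⟩ := h.exists_sign_transport_etaDd hkum hδYdd hδ
  · left
    rw [hT, hw, map_one, map_one, map_one, one_mul]
  · right
    rw [hT, hw]

/-- **h14orbit at the root** (the ORBIT form the [IUTchII] Prop. 2.2 (ii) consumers bind): GRANTED, in addition, the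
class-level deck-sign clause «`conj_ε(η̈^Θ) = κ(−1)·η̈^Θ`» for some `ε ∈ Π^tp_Y` (Prop. 1.4 (ii) `Θ̈(−Ü) = −Θ̈(Ü)` read on
classes; the non-trivial deck transformation of `Ÿ → Y`), the transported class lies in the `Π^tp_Y`-orbit of `η̈^Θ`:
`transport_ι(η̈^Θ) = conj_{τ₀}(η̈^Θ)` with `τ₀ ∈ {1, ε} ⊆ Π^tp_Y`. [cite: MochizukiEtTh2009, Thm 1.6 (iii) p.25] -/
theorem exists_mem_GtpY_transport_etaDd_eq_conj [D.GtpYdd.Normal] (h : InvClauses E hι cι)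
    (hkum : ∀ a : E.KddHat, transport cι hι.thm16i (D.inflTheta D.GtpYdd (E.kumYdd a)) =
      D.inflTheta D.GtpYdd (E.kumYdd a))
    {δ : D.PiTemp} (hδYdd : δ ∈ D.GtpYdd) (hδ : ∀ x, ι (ι x) = δ * x * δ⁻¹)
    {ε : D.PiTemp} (hε : ε ∈ D.GtpY)
    (hdeck : ContH1.conj D.toTheta D.DeltaTheta ε E.etaDd =
      D.inflTheta D.GtpYdd (E.kumYdd (E.toKddHat (-1))) * E.etaDd) :
    ∃ τ₀ ∈ D.GtpY, transport cι hι.thm16i E.etaDd = ContH1.conj D.toTheta D.DeltaTheta τ₀ E.etaDd := by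
  rcases h.transport_etaDd_eq_or hkum hδYdd hδ with hT | hT
  · refine ⟨1, one_mem _, ?_⟩
    rw [hT, ContH1.conj_one_apply]
  · exact ⟨ε, hε, by rw [hT, hdeck]⟩

end InvClauses

/-! ### From the FACT-shaped root predicate `Prop15iiiInvAnchored` -/

/-- **The sign statement from `Prop15iiiInvAnchored`** + one ANCHORED cuspidal point of `Ÿ` over the component labelled `0`
whose cusp is fixed by `ι` (the normalisation of Prop. 1.5 (iii), p. 23 / Thm. 1.6 (iii) proof p. 25 l. 33–34), granted
(h_kum) and (h_sq) as above. [cite: MochizukiEtTh2009, Prop 1.5 (iii) p.23] -/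
theorem exists_sign_transport_etaDd_of_prop15iiiInvAnchored [D.GtpYdd.Normal] {E : D.EtaleThetaData}
    (h15 : D.Prop15iiiInvAnchored E) {ι : D.PiTemp ≃ₜ* D.PiTemp} (hι : D.IsInversionAut ι) (cι : ThetaCompanion ι)
    (y : CuspidalPointDd E.toKummerData) (hyA : y.IsAnchored) (hy0 : y.IsOnLabelZero) (hyfix : D.FixesCuspBelow ι y)
    (hkum : ∀ a : E.KddHat, transport cι hι.thm16i (D.inflTheta D.GtpYdd (E.kumYdd a)) =
      D.inflTheta D.GtpYdd (E.kumYdd a))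
    {δ : D.PiTemp} (hδYdd : δ ∈ D.GtpYdd) (hδ : ∀ x, ι (ι x) = δ * x * δ⁻¹) :
    ∃ w ∈ D.unitsOKdd, (w = 1 ∨ w = -1) ∧
      transport cι hι.thm16i E.etaDd = D.inflTheta D.GtpYdd (E.kumYdd (E.toKddHat w)) * E.etaDd :=
  (h15 ι hι cι y hyA hy0 hyfix).exists_sign_transport_etaDd hkum hδYdd hδ

/-! ### Appended v2: the clause (h_kum) DISCHARGED from Prop. 1.5 (ii) — so the sign needs (h_sq) only -/

/-- **An inversion fixes every class of `F̈²`, inflated to `Π^tp_Ÿ`** («`F̈² = H¹(G_K̈, Δ_Θ)`», Prop. 1.5 (ii) p. 23, the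
classes «from the base»): for `z ∈ F̈² = Ker(H¹((Π^tp_Ÿ)^Θ) → H¹((Δ^tp_Ÿ)^Θ))`, `transport_ι(infl z) = infl z`.
PROOF (cocycle level): a representative `c` of `z` VANISHES on `(Δ^tp_Ÿ)^Θ` (abc-iut-L2-t2's
`cocycle_apply_eq_one_of_mem_Fdd2` — `Δ_Θ` is central there); the transported cocycle is
`y ↦ ι^Θ(c((ι⁻¹y)^Θ))`; now `ι^Θ = id` on `Δ_Θ` (`IsInversionAut.thetaIso_apply_eq_self`, abc-iut-L2-t1 g5) and
`(ι⁻¹y)^Θ = y^Θ · d^Θ` with `d := y⁻¹·ι⁻¹(y) ∈ Δ^tp_Ÿ` because `ι` lies over `K` (`aug ∘ ι = aug`), where `c` kills `d^Θ`.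
[cite: MochizukiEtTh2009, Prop 1.5 (ii) p.23] -/
theorem IsInversionAut.transport_inflTheta_eq_self_of_mem_Fdd2 {ι : D.PiTemp ≃ₜ* D.PiTemp}
    (hι : D.IsInversionAut ι) (cι : ThetaCompanion ι) {z : D.H1Theta (D.GtpYdd.map D.toTheta)}
    (hz : z ∈ (Fdd2 : Subgroup (D.H1Theta (D.GtpYdd.map D.toTheta)))) :
    transport cι hι.thm16i (D.inflTheta D.GtpYdd z) = D.inflTheta D.GtpYdd z := by
  obtain ⟨c, rfl⟩ := QuotientGroup.mk_surjective z
  change (QuotientGroup.mk (transportCocycle cι hι.thm16i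
      (ContH1.inflCocycle D.DeltaTheta D.toTheta D.continuous_toTheta le_rfl c)) : D.H1 D.GtpYdd) =
    QuotientGroup.mk (ContH1.inflCocycle D.DeltaTheta D.toTheta D.continuous_toTheta le_rfl c)
  congr 1
  apply Subtype.ext
  funext y
  apply Subtype.ext
  -- the point `(ι⁻¹ y)^Θ` of `(Π^tp_Ÿ)^Θ` splits as `y^Θ · d^Θ` with `d ∈ Δ^tp_Ÿ`
  set y' : D.GtpYdd := ⟨ι.toMulEquiv.symm y.1, symm_mem_GtpYdd hι.thm16i y⟩ with hy'
  have hdYdd : (y.1)⁻¹ * y'.1 ∈ D.GtpYdd := D.GtpYdd.mul_mem (D.GtpYdd.inv_mem y.2) y'.2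
  have hdaug : D.aug.toMonoidHom ((y.1)⁻¹ * y'.1) = 1 := by
    have haug : D.aug (ι.toMulEquiv y'.1) = D.aug y'.1 := hι.aug_apply y'.1
    have hyy : ι.toMulEquiv y'.1 = y.1 := ι.toMulEquiv.apply_symm_apply y.1
    rw [hyy] at haug
    change D.aug ((y.1)⁻¹ * y'.1) = 1
    rw [map_mul, map_inv, haug, inv_mul_cancel]
  have hd : D.toTheta ((y.1)⁻¹ * y'.1) ∈ (D.DtpYddN 1).map D.toTheta :=
    ⟨(y.1)⁻¹ * y'.1, Subgroup.mem_inf.2 ⟨by change (y.1)⁻¹ * y'.1 ∈ D.GtpYdd; exact hdYdd, hdaug⟩, rfl⟩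
  have hd' : D.toTheta ((y.1)⁻¹ * y'.1) ∈ D.GtpYdd.map D.toTheta :=
    Subgroup.map_mono (inf_le_left : D.DtpYddN 1 ≤ D.GtpYddN 1) hd
  have hsplit : (⟨D.toTheta y'.1, ⟨y'.1, y'.2, rfl⟩⟩ : D.GtpYdd.map D.toTheta) =
      ⟨D.toTheta y.1, ⟨y.1, y.2, rfl⟩⟩ * ⟨_, hd'⟩ := by
    apply Subtype.ext
    change D.toTheta y'.1 = D.toTheta y.1 * D.toTheta ((y.1)⁻¹ * y'.1)
    rw [← map_mul, mul_inv_cancel_left]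
  -- LHS and RHS values
  have L : ((((transportCocycle cι hι.thm16i
        (ContH1.inflCocycle D.DeltaTheta D.toTheta D.continuous_toTheta le_rfl c)).1 y) : D.DeltaTheta) :
        D.GtpTheta) =
      cι.thetaIso.toMulEquiv (c.1 ⟨D.toTheta y'.1, ⟨y'.1, y'.2, rfl⟩⟩).1 := rfl
  have R : ((((ContH1.inflCocycle D.DeltaTheta D.toTheta D.continuous_toTheta le_rfl c).1 y) : D.DeltaTheta) :
        D.GtpTheta) = (c.1 ⟨D.toTheta y.1, ⟨y.1, y.2, rfl⟩⟩).1 := rfl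
  rw [L, R, hsplit, c.2.2, cocycle_apply_eq_one_of_mem_Fdd2 c hz ⟨_, hd'⟩ hd, map_one, mul_one]
  exact hι.thetaIso_apply_eq_self cι (c.1 _).2

/-- **(h_kum) from Prop. 1.5 (ii)**: an inversion automorphism fixes the inflated Kummer classes of ALL constants
(`F̈² = κ((K̈^×)^∧)`, `Prop15ii.Fdd2_eq`). [cite: MochizukiEtTh2009, Prop 1.5 (ii) p.23] -/
theorem IsInversionAut.transport_infl_kumYdd_eq_self {ι : D.PiTemp ≃ₜ* D.PiTemp} (hι : D.IsInversionAut ι)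
    (cι : ThetaCompanion ι) (E : D.KummerData) (hC : D.Compat) (h15ii : Prop15ii E hC) (a : E.KddHat) :
    transport cι hι.thm16i (D.inflTheta D.GtpYdd (E.kumYdd a)) = D.inflTheta D.GtpYdd (E.kumYdd a) :=
  hι.transport_inflTheta_eq_self_of_mem_Fdd2 cι (by rw [h15ii.Fdd2_eq]; exact ⟨a, rfl⟩)

/-- **The sign statement with (h_kum) DISCHARGED**: for an inversion automorphism satisfying the inversion clause of
Prop. 1.5 (iii), GRANTED Prop. 1.5 (ii) (the K3 knits' standing binder) and (h_sq) «`ι² = conj_δ`, `δ ∈ Π^tp_Ÿ`» ONLY: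
`transport_ι(η̈^Θ) = κ(w)·η̈^Θ` with `w = ±1`. [cite: MochizukiEtTh2009, Prop 1.5 (iii) p.23] -/
theorem InvClauses.exists_sign_transport_etaDd_of_prop15ii [D.GtpYdd.Normal] {E : D.EtaleThetaData}
    {ι : D.PiTemp ≃ₜ* D.PiTemp} {hι : D.IsInversionAut ι} {cι : ThetaCompanion ι} (h : InvClauses E hι cι)
    (hC : D.Compat) (h15ii : Prop15ii E.toKummerData hC)
    {δ : D.PiTemp} (hδYdd : δ ∈ D.GtpYdd) (hδ : ∀ x, ι (ι x) = δ * x * δ⁻¹) :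
    ∃ w ∈ D.unitsOKdd, (w = 1 ∨ w = -1) ∧
      transport cι hι.thm16i E.etaDd = D.inflTheta D.GtpYdd (E.kumYdd (E.toKddHat w)) * E.etaDd :=
  h.exists_sign_transport_etaDd (hι.transport_infl_kumYdd_eq_self cι E.toKummerData hC h15ii) hδYdd hδ

/-- **h14orbit at the root with (h_kum) discharged**: the ORBIT form from {`InvClauses`, Prop. 1.5 (ii), (h_sq), the
class-level deck-sign clause}. [cite: MochizukiEtTh2009, Thm 1.6 (iii) p.25] -/
theorem InvClauses.exists_mem_GtpY_transport_etaDd_eq_conj_of_prop15ii [D.GtpYdd.Normal] {E : D.EtaleThetaData}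
    {ι : D.PiTemp ≃ₜ* D.PiTemp} {hι : D.IsInversionAut ι} {cι : ThetaCompanion ι} (h : InvClauses E hι cι)
    (hC : D.Compat) (h15ii : Prop15ii E.toKummerData hC)
    {δ : D.PiTemp} (hδYdd : δ ∈ D.GtpYdd) (hδ : ∀ x, ι (ι x) = δ * x * δ⁻¹)
    {ε : D.PiTemp} (hε : ε ∈ D.GtpY)
    (hdeck : ContH1.conj D.toTheta D.DeltaTheta ε E.etaDd =
      D.inflTheta D.GtpYdd (E.kumYdd (E.toKddHat (-1))) * E.etaDd) :
    ∃ τ₀ ∈ D.GtpY, transport cι hι.thm16i E.etaDd = ContH1.conj D.toTheta D.DeltaTheta τ₀ E.etaDd :=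
  h.exists_mem_GtpY_transport_etaDd_eq_conj (hι.transport_infl_kumYdd_eq_self cι E.toKummerData hC h15ii)
    hδYdd hδ hε hdeck

/-- **From the FACT-shaped root predicates only** (+ (h_sq)): `Prop15iiiInvAnchored` + an anchored label-`0` cusp fixed by
`ι` + `Prop15ii` ⇒ the sign statement. [cite: MochizukiEtTh2009, Prop 1.5 (iii) p.23] -/
theorem exists_sign_transport_etaDd_of_prop15 [D.GtpYdd.Normal] {E : D.EtaleThetaData}
    (hC : D.Compat) (h15ii : Prop15ii E.toKummerData hC) (h15 : D.Prop15iiiInvAnchored E)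
    {ι : D.PiTemp ≃ₜ* D.PiTemp} (hι : D.IsInversionAut ι) (cι : ThetaCompanion ι)
    (y : CuspidalPointDd E.toKummerData) (hyA : y.IsAnchored) (hy0 : y.IsOnLabelZero) (hyfix : D.FixesCuspBelow ι y)
    {δ : D.PiTemp} (hδYdd : δ ∈ D.GtpYdd) (hδ : ∀ x, ι (ι x) = δ * x * δ⁻¹) :
    ∃ w ∈ D.unitsOKdd, (w = 1 ∨ w = -1) ∧
      transport cι hι.thm16i E.etaDd = D.inflTheta D.GtpYdd (E.kumYdd (E.toKddHat w)) * E.etaDd :=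
  (h15 ι hι cι y hyA hy0 hyfix).exists_sign_transport_etaDd_of_prop15ii hC h15ii hδYdd hδ

/-! ### Appended v3: the clause (h_sq) located — `δ ∈ Π^tp_Y` is automatic, and its DECK CLASS decides the orbit form -/

namespace IsInversionAut

variable {ι : D.PiTemp ≃ₜ* D.PiTemp}

/-- An element FIXED by an inversion automorphism lies in `Π^tp_Y`: `ι` acts by `−1` on `Z = Π^tp_X/Π^tp_Y`
(`toZ_apply`), and `ℤ` has no `2`-torsion. [cite: MochizukiEtTh2009, Prop 1.5 (iii) p.23] -/
theorem mem_GtpY_of_apply_eq (hι : D.IsInversionAut ι) {δ : D.PiTemp} (hfix : ι δ = δ) : δ ∈ D.GtpY := by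
  have h := hι.toZ_apply δ
  rw [hfix] at h
  -- `toZ δ = (toZ δ)⁻¹` in `Multiplicative ℤ`
  have h2 : Multiplicative.toAdd (D.toZ δ) = - Multiplicative.toAdd (D.toZ δ) := by
    rw [← toAdd_inv, ← h]
  have h0 : Multiplicative.toAdd (D.toZ δ) = 0 := by omega
  change δ ∈ D.toZ.ker
  rw [MonoidHom.mem_ker]
  exact Multiplicative.toAdd.injective (by rw [h0, toAdd_one])

/-- **If `ι² = conj_δ` and `Π^tp_X` is centre-free (temp-slim), then `ι` fixes `δ`** — compute `ι³` in two ways: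
`conj_{ι(δ)} ∘ ι = ι ∘ conj_δ = ι³ = conj_δ ∘ ι`, so `δ⁻¹·ι(δ)` is central. [cite: MochizukiEtTh2009, Prop 1.5 (iii) p.23] -/
theorem apply_eq_self_of_sq_inner {δ : D.PiTemp} (hδ : ∀ x, ι (ι x) = δ * x * δ⁻¹)
    (hZ : Subgroup.center D.PiTemp = ⊥) : ι δ = δ := by
  have hc : δ⁻¹ * ι δ ∈ Subgroup.center D.PiTemp := by
    rw [Subgroup.mem_center_iff]
    intro y
    -- `ι³ y'` two ways, with `y = ι y'`
    obtain ⟨x, rfl⟩ := ι.surjective y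
    have h1 : ι (ι (ι x)) = ι δ * ι x * (ι δ)⁻¹ := by rw [hδ x, map_mul, map_mul, map_inv]
    have h2 : ι (ι (ι x)) = δ * ι x * δ⁻¹ := hδ (ι x)
    have h3 : ι δ * ι x * (ι δ)⁻¹ = δ * ι x * δ⁻¹ := h1.symm.trans h2
    -- rearrange: `(δ⁻¹ ι δ) (ι x) = (ι x) (δ⁻¹ ι δ)`
    have h4 : δ⁻¹ * ι δ * ι x = ι x * (δ⁻¹ * ι δ) := by
      have := congrArg (fun t => δ⁻¹ * t * ι δ) h3
      simp only [mul_assoc, inv_mul_cancel, mul_one, inv_mul_cancel_left] at this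
      simpa [mul_assoc] using this
    exact h4.symm
  rw [hZ, Subgroup.mem_bot] at hc
  have := congrArg (fun t => δ * t) hc
  simpa using this

/-- **(h_sq) located**: under `ι² = conj_δ` with `Π^tp_X` centre-free, `δ ∈ Π^tp_Y` AUTOMATICALLY — so the clause
«`δ ∈ Π^tp_Ÿ`» is exactly the (`ℤ/2`-valued) DECK CLASS of `δ` in `Π^tp_Y/Π^tp_Ÿ ≅ Gal(Ÿ/Y)`.
[cite: MochizukiEtTh2009, Prop 1.5 (iii) p.23] -/
theorem sqInner_mem_GtpY (hι : D.IsInversionAut ι) {δ : D.PiTemp} (hδ : ∀ x, ι (ι x) = δ * x * δ⁻¹)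
    (hZ : Subgroup.center D.PiTemp = ⊥) : δ ∈ D.GtpY :=
  hι.mem_GtpY_of_apply_eq (apply_eq_self_of_sq_inner hδ hZ)

end IsInversionAut

namespace InvClauses

variable {E : D.EtaleThetaData} {ι : D.PiTemp ≃ₜ* D.PiTemp} {hι : D.IsInversionAut ι} {cι : ThetaCompanion ι}

/-- **NEGATIVE direction — the deck class obstructs.** If `ι² = conj_δ` with `δ` a DECK element (`δ ∈ Π^tp_Y ∖ Π^tp_Ÿ`)
and the class-level deck-sign clause «`conj_δ(η̈^Θ) = κ(−1)·η̈^Θ`» holds for it, then (granted Prop. 1.5 (ii))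
`transport_ι(η̈^Θ)` is NOT in the `Π^tp_Y`-orbit `{η̈^Θ, κ(−1)·η̈^Θ}`: its unit `w` has `w² = −1`, while `±1` square to
`1 ≠ −1` (`K̈` has characteristic `0`). [cite: MochizukiEtTh2009, Prop 1.5 (iii) p.23] -/
theorem transport_etaDd_not_mem_orbit_of_sq_deck [D.GtpYdd.Normal] (h : InvClauses E hι cι)
    (hC : D.Compat) (h15ii : Prop15ii E.toKummerData hC)
    {δ : D.PiTemp} (hδ : ∀ x, ι (ι x) = δ * x * δ⁻¹)
    (hdeck : ContH1.conj D.toTheta D.DeltaTheta δ E.etaDd =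
      D.inflTheta D.GtpYdd (E.kumYdd (E.toKddHat (-1))) * E.etaDd) :
    ¬ (transport cι hι.thm16i E.etaDd = E.etaDd ∨
        transport cι hι.thm16i E.etaDd = D.inflTheta D.GtpYdd (E.kumYdd (E.toKddHat (-1))) * E.etaDd) := by
  obtain ⟨w, -, hsq, hT⟩ := h.toKddHat_sq_eq_of_sq_inner
    (hι.transport_infl_kumYdd_eq_self cι E.toKummerData hC h15ii) hδ hdeck
  have hww : w * w = -1 := E.toKddHat_injective hsq
  -- if `transport η̈ = κ(u)·η̈` with `u ∈ {1, −1}` then `w = u`, so `w² = 1 ≠ −1`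
  have hkey : ∀ u : (↥D.Kdd)ˣ, transport cι hι.thm16i E.etaDd =
      D.inflTheta D.GtpYdd (E.kumYdd (E.toKddHat u)) * E.etaDd → w = u := by
    intro u hu
    rw [hT] at hu
    have h1 : D.inflTheta D.GtpYdd (E.kumYdd (E.toKddHat w)) = D.inflTheta D.GtpYdd (E.kumYdd (E.toKddHat u)) :=
      mul_right_cancel hu
    exact E.toKddHat_injective (Thm16Sub.inflKum_injective E.toKummerData h1)
  have htwo : (2 : D.Kdd) ≠ 0 := two_ne_zero
  rintro (h1 | h1)
  · have hw : w = 1 := hkey 1 (by rw [h1, map_one, map_one, map_one, one_mul])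
    rw [hw, one_mul] at hww
    have h2 := congrArg (fun u : (↥D.Kdd)ˣ => (u : D.Kdd)) hww
    simp only [Units.val_one, Units.val_neg] at h2
    apply htwo
    linear_combination h2
  · have hw : w = -1 := hkey (-1) h1
    rw [hw] at hww
    have h2 := congrArg (fun u : (↥D.Kdd)ˣ => (u : D.Kdd)) hww
    simp only [Units.val_mul, Units.val_neg, Units.val_one] at h2
    apply htwo
    linear_combination h2

/-- **THE DIVIDING LINE as an `iff`.** For an inversion datum with `ι² = conj_δ`, `δ ∈ Π^tp_Y` (automatic for centre-free
`Π^tp_X`, `IsInversionAut.sqInner_mem_GtpY`), granted Prop. 1.5 (ii), the inversion clause and the class-level deck-sign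
clause for every deck element: `transport_ι(η̈^Θ) ∈ {η̈^Θ, κ(−1)·η̈^Θ}` (the h14orbit sign form) **iff `δ ∈ Π^tp_Ÿ`**.
[cite: MochizukiEtTh2009, Prop 1.5 (iii) p.23] -/
theorem transport_etaDd_mem_orbit_iff_sq_mem_GtpYdd [D.GtpYdd.Normal] (h : InvClauses E hι cι)
    (hC : D.Compat) (h15ii : Prop15ii E.toKummerData hC)
    {δ : D.PiTemp} (hδY : δ ∈ D.GtpY) (hδ : ∀ x, ι (ι x) = δ * x * δ⁻¹)
    (hdeckAll : ∀ ε ∈ D.GtpY, ε ∉ D.GtpYdd → ContH1.conj D.toTheta D.DeltaTheta ε E.etaDd =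
      D.inflTheta D.GtpYdd (E.kumYdd (E.toKddHat (-1))) * E.etaDd) :
    (transport cι hι.thm16i E.etaDd = E.etaDd ∨
        transport cι hι.thm16i E.etaDd = D.inflTheta D.GtpYdd (E.kumYdd (E.toKddHat (-1))) * E.etaDd) ↔
      δ ∈ D.GtpYdd := by
  constructor
  · intro horb
    by_contra hnot
    exact h.transport_etaDd_not_mem_orbit_of_sq_deck hC h15ii hδ (hdeckAll δ hδY hnot) horb
  · intro hδYdd
    exact h.transport_etaDd_eq_or (hι.transport_infl_kumYdd_eq_self cι E.toKummerData hC h15ii) hδYdd hδ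

end InvClauses

/-! ### Appended v3 (cont.): the class-level deck-sign clause from the FUNCTION-level Prop. 1.4 (ii) package -/

/-- **The class-level deck-sign clause «`conj_ε(η̈^Θ) = κ(−1)·η̈^Θ`» from the function level**: if `η̈^Θ = κ(Θ̈)` for a
`ThetaKummerInput` `T` compatible with the abstract Kummer theory of constants (`ConstCompat`, F-0618 shape) and the deck
transformations act by `Θ̈ ↦ −Θ̈` (Prop. 1.4 (ii) «`Θ̈(−Ü) = −Θ̈(Ü)`», abc-iut-w5-d125's `conj_kummerTheta_of_deck`), then every
deck element `ε ∈ Π^tp_Y ∖ Π^tp_Ÿ` satisfies the clause consumed above. [cite: MochizukiEtTh2009, Prop 1.4 (ii) p.22] -/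
theorem EtaleThetaData.conj_etaDd_eq_of_deck_of_thetaKummer [D.GtpYdd.Normal] (E : D.EtaleThetaData)
    (T : D.ThetaKummerInput) (hη : E.etaDd = T.kummerTheta) (hcc : T.ConstCompat E.toKummerData)
    (hdeck : ∀ ε : D.PiTemp, ε ∈ D.GtpY → ε ∉ D.GtpYdd → ε • T.theta = T.const (-1) * T.theta)
    {ε : D.PiTemp} (hε₁ : ε ∈ D.GtpY) (hε₂ : ε ∉ D.GtpYdd) :
    ContH1.conj D.toTheta D.DeltaTheta ε E.etaDd = D.inflTheta D.GtpYdd (E.kumYdd (E.toKddHat (-1))) * E.etaDd := by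
  rw [hcc (-1), hη]
  exact T.conj_kummerTheta_of_deck hdeck hε₁ hε₂

/-- **h14orbit at the ROOT from print-level inputs only** (+ the deck class of `ι²`): {`InvClauses` (⟸ Prop. 1.5 (iii)),
Prop. 1.5 (ii), the function-level Prop. 1.4 (ii) package (`η̈^Θ = κ(Θ̈)`, `ConstCompat`, `Θ̈ ↦ −Θ̈` under deck
transformations), a deck element `ε`, and `ι² = conj_δ` with `δ ∈ Π^tp_Ÿ`} ⇒ `∃ τ₀ ∈ Π^tp_Y, transport_ι(η̈^Θ) = conj_{τ₀}(η̈^Θ)`.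
[cite: MochizukiEtTh2009, Thm 1.6 (iii) p.25] -/
theorem InvClauses.exists_mem_GtpY_transport_etaDd_eq_conj_of_thetaKummer [D.GtpYdd.Normal] {E : D.EtaleThetaData}
    {ι : D.PiTemp ≃ₜ* D.PiTemp} {hι : D.IsInversionAut ι} {cι : ThetaCompanion ι} (h : InvClauses E hι cι)
    (hC : D.Compat) (h15ii : Prop15ii E.toKummerData hC)
    (T : D.ThetaKummerInput) (hη : E.etaDd = T.kummerTheta) (hcc : T.ConstCompat E.toKummerData)
    (hdeck : ∀ ε : D.PiTemp, ε ∈ D.GtpY → ε ∉ D.GtpYdd → ε • T.theta = T.const (-1) * T.theta)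
    {ε : D.PiTemp} (hε₁ : ε ∈ D.GtpY) (hε₂ : ε ∉ D.GtpYdd)
    {δ : D.PiTemp} (hδYdd : δ ∈ D.GtpYdd) (hδ : ∀ x, ι (ι x) = δ * x * δ⁻¹) :
    ∃ τ₀ ∈ D.GtpY, transport cι hι.thm16i E.etaDd = ContH1.conj D.toTheta D.DeltaTheta τ₀ E.etaDd :=
  h.exists_mem_GtpY_transport_etaDd_eq_conj_of_prop15ii hC h15ii hδYdd hδ hε₁
    (E.conj_etaDd_eq_of_deck_of_thetaKummer T hη hcc hdeck hε₁ hε₂)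

end ThetaSetting

end Literature.AnabelianGeometry.EtaleTheta

end
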